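import Mathlib
import Summits.NavierStokesRegularity.NavierStokesRegularity.Theorems.LandauTailLandauTailBlowupEngine
import Summits.NavierStokesRegularity.NavierStokesRegularity.Theorems.LandauTailLandauTailBlowupScaledTest
import Summits.NavierStokesRegularity.NavierStokesRegularity.Theorems.LandauTailLandauTailBlowupDefectInequality

/-!
# Crux `LandauTail.LandauTailBlowup` (stmt-NavierStokesRegularity-1944), line `registered`, cycle c6:
  stub `landauTail_defect_floor_engine` — the quantitative flux theorem (scaled `L²`-defect floor)

Helper file on the proof path of the crux item `stmt-NavierStokesRegularity-1944`
(`Summit.NavierStokesRegularity.NavierStokesRegularity.Theses.LandauTail.LandauTailBlowup`), lead c6: the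
registered support stub `landauTail_defect_floor_engine` (A6).

THEOREM. For a nonzero steady `(−1)`-homogeneous Navier–Stokes profile `(U, P)` smooth off the origin (a Landau
solution `landauAxisField a A`, Šverák 2011) there is `c = c(U) > 0` such that for EVERY sequence `(w n, π n)` of
classical unit-viscosity solutions of the unforced system on `ℝ³ × (−1, 0)` converging pointwise off the time axis
to `U`, every core ratio `ρ ∈ (0, 1]` and every window `−1 ≤ s₁ < s₂ ≤ 0`,

  `liminf_n ∫_{s₁}^{s₂} ∫_{B_ρ} |w n − U|² ≥ c ρ (s₂ − s₁)`,   `c = 2π β(A) / (3 (K + 1))`,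

`β(A) > 0` Landau's flux constant (`landauTail_landau_flux_pos`) and `K` the gradient constant of the scaled
solenoidal tests (`landauTail_exists_divFree_test_scaled`). Since `∫_{B_ρ}|U|² ∼ ρ` as well, the `L²`-deviation
from the Landau flow in every core tube is a fixed fraction of Landau's own `L²` mass there, uniformly in `ρ`:
the blow-up rescalings of a Landau-tailed singularity never converge to `U` in `L²_loc`, and the defect is as
large as the profile at every sub-parabolic scale (the energy-level, `q = 2`, form of the momentum-flux argument;
the c5 theorems p162027/p163730 gave divergence of the scaled `L^q` norms only for `q > 2`).

PROOF. Test the very weak identity with `ψ = θ(t) φ_ρ(x)`, `θ` a bump of the window with `∫θ ≥ (s₂−s₁)/3`,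
`φ_ρ` solenoidal in `B_ρ` with `φ_ρ(0) = a`, `‖∇φ_ρ‖ ≤ K/ρ`: the Landau flux identity gives
`∫∫F(U) = −(∫θ)·2πβ(A)`, while the defect inequality `landauTail_veryWeak_defect_le` (along a subsequence on
which the defects stay below the level, hence are `L²(S)`-bounded) gives `‖∫∫F(U)‖ ≤ (K+1)/ρ · liminf ∫∫_S|w n − U|²`.

References: L. D. Landau 1944; P. G. Lemarié-Rieusset 2016, (10.48); D. Chae 2007, proof of Thm 1.5 (p. 8);
G. Koch, N. Nadirashvili, G. Seregin, V. Šverák 2009, §4 (ii).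
-/

set_option linter.dupNamespace false

noncomputable section

open Filter Set Topology MeasureTheory Metric Function
open scoped ENNReal NNReal InnerProductSpace RealInnerProductSpace Laplacian ContDiff
open Literature.Analysis.FluidPDE

namespace Summit.NavierStokesRegularity.NavierStokesRegularity.Theorems

/-- The support of a product test field `(t, x) ↦ θ t • φ x` lies in `tsupport θ ×ˢ tsupport φ`. [folklore] -/
theorem landauTail_tsupport_smul_subset {θ : ℝ → ℝ}
    {φ : EuclideanSpace ℝ (Fin 3) → EuclideanSpace ℝ (Fin 3)} :
    tsupport (uncurry fun t x => θ t • φ x) ⊆ tsupport θ ×ˢ tsupport φ := by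
  have hzero : ∀ z : ℝ × EuclideanSpace ℝ (Fin 3), z ∉ tsupport θ ×ˢ tsupport φ →
      θ z.1 • φ z.2 = 0 := by
    intro z hz
    rw [mem_prod, not_and_or] at hz
    rcases hz with h | h
    · rw [image_eq_zero_of_notMem_tsupport h, zero_smul]
    · rw [image_eq_zero_of_notMem_tsupport h, smul_zero]
  exact closure_minimal (fun z hz => by_contra fun h => hz (hzero z h))
    ((isClosed_tsupport θ).prod (isClosed_tsupport φ))

/-- `‖U‖_{L^{5/2}(B₁)} < ∞` for a `(−1)`-homogeneous field continuous off the origin. [folklore] -/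
theorem landauTail_eLpNorm_profile_five_halves_lt_top
    {U : EuclideanSpace ℝ (Fin 3) → EuclideanSpace ℝ (Fin 3)}
    (hU : ContinuousOn U {0}ᶜ) (hhom : ∀ c : ℝ, 0 < c → ∀ x, U (c • x) = c⁻¹ • U x) :
    eLpNorm U (5 / 2) (volume.restrict (ball (0 : EuclideanSpace ℝ (Fin 3)) 1)) < ⊤ := by
  have h0 : (5 / 2 : ℝ≥0∞) ≠ 0 := by simp
  have htop : (5 / 2 : ℝ≥0∞) ≠ ⊤ := by
    rw [Ne, ENNReal.div_eq_top]; simp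
  have hr : (5 / 2 : ℝ≥0∞).toReal = 5 / 2 := by rw [ENNReal.toReal_div]; simp
  rw [eLpNorm_eq_lintegral_rpow_enorm_toReal h0 htop, hr]
  refine ENNReal.rpow_lt_top_of_nonneg (by norm_num) ?_
  exact (landauTail_lintegral_profile_rpow_lt_top hU hhom (by norm_num) (by norm_num)).ne

/-- **The quantitative flux theorem — scaled `L²`-defect floor, engine form** (registered support stub A6 of crux
stmt-NavierStokesRegularity-1944, lead c6; Landau 1944, Lemarié-Rieusset 2016 (10.48), Chae 2007 p. 8, KNSS
2009 §4 (ii)). For a nonzero steady `(−1)`-homogeneous profile `(U, P)` smooth off the origin there is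
`c = c(U) > 0` such that every sequence of classical unit-viscosity flows on `ℝ³ × (−1,0)` converging pointwise
off the time axis to `U` satisfies `liminf_n ∫_{s₁}^{s₂}∫_{B_ρ} |w n − U|² ≥ c ρ (s₂ − s₁)` for all
`ρ ∈ (0,1]`, `−1 ≤ s₁ < s₂ ≤ 0`. -/
theorem landauTail_defect_floor_engine : ∀ (U : EuclideanSpace ℝ (Fin 3) → EuclideanSpace ℝ (Fin 3)) (P : EuclideanSpace ℝ (Fin 3) → ℝ), (ContDiffOn ℝ (⊤ : ℕ∞) U {0}ᶜ ∧ ContDiffOn ℝ (⊤ : ℕ∞) P {0}ᶜ ∧ (∀ x : EuclideanSpace ℝ (Fin 3), x ≠ 0 → Literature.Analysis.FluidPDE.convect U U x + gradient P x = (1 : ℝ) • Laplacian.laplacian U x) ∧ (∀ x : EuclideanSpace ℝ (Fin 3), x ≠ 0 → Literature.Analysis.FluidPDE.VectorCalculus.divergence U x = 0) ∧ (∀ c : ℝ, 0 < c → ∀ x : EuclideanSpace ℝ (Fin 3), U (c • x) = c⁻¹ • U x) ∧ (∃ x : EuclideanSpace ℝ (Fin 3), U x ≠ 0)) → ∃ c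 : ℝ, 0 < c ∧ ∀ (w : ℕ → ℝ → EuclideanSpace ℝ (Fin 3) → EuclideanSpace ℝ (Fin 3)) (π : ℕ → ℝ → EuclideanSpace ℝ (Fin 3) → ℝ), (∀ n, Literature.Analysis.FluidPDE.IsClassicalNSSolutionOn (Set.Ioo (-1) 0) 1 0 (w n) (π n)) → (∀ τ ∈ Set.Ioo (-1 : ℝ) 0, ∀ y : EuclideanSpace ℝ (Fin 3), y ≠ 0 → Filter.Tendsto (fun n => w n τ y) Filter.atTop (nhds (U y))) → ∀ ρ : ℝ, 0 < ρ → ρ ≤ 1 → ∀ s₁ s₂ : ℝ, -1 ≤ s₁ → s₁ < s₂ → s₂ ≤ 0 → ENNReal.ofReal (c * ρ * (s₂ - s₁)) ≤ Filter.liminf (fun n => ∫⁻ z in Set.Ioo s₁ s₂ ×ˢ Metric.ball (0 : EuclideanSpace ℝ (Fin 3)) ρ, ‖w n z.1 z.2 - U z.2‖ₑ ^ 2) Filter.atTop := by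
  intro U P hprof
  obtain ⟨hUs, hPs, hNS, hdiv, hhom, hne⟩ := hprof
  have hUc : ContinuousOn U {0}ᶜ := hUs.continuousOn
  -- Šverák's normal form, the scaled solenoidal tests, Landau's flux constant
  obtain ⟨a, ha, A, hA, hUeq⟩ := landauTail_exists_axis_of_profile one_pos hUs hPs hNS hdiv hhom hne
  obtain ⟨K, hK0, hφfam⟩ := landauTail_exists_divFree_test_scaled a
  set β₀ : ℝ := 8 * A / 3 * (3 * A ^ 2 + 1) / (A ^ 2 - 1) - 4 * A ^ 2 * Real.log ((A + 1) / (A - 1))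
    with hβ₀_def
  have hβ₀ : 0 < β₀ := landauTail_landau_flux_pos A hA
  set Φ : ℝ := 2 * Real.pi * β₀ with hΦ_def
  have hΦ : 0 < Φ := by have := Real.pi_pos; positivity
  refine ⟨Φ / (3 * (K + 1)), by positivity, ?_⟩
  intro w π hwcl hptw ρ hρ hρ1 s₁ s₂ hs₁ hs₁₂ hs₂
  set L : ℝ := s₂ - s₁ with hL_def
  have hL : 0 < L := by rw [hL_def]; linarith
  -- the test field `ψ = θ(t) φ(x)`
  obtain ⟨φ, hφs, hφc, hφsupp, hφdiv, hφ0, -, hφD⟩ := hφfam ρ hρ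
  have hφsupp1 : tsupport φ ⊆ ball (0 : EuclideanSpace ℝ (Fin 3)) 1 := hφsupp.trans (ball_subset_ball hρ1)
  let θb : ContDiffBump ((s₁ + s₂) / 2 : ℝ) := ⟨L / 6, L / 3, by positivity, by linarith⟩
  have hθs : ContDiff ℝ ∞ θb := θb.contDiff
  have hθsuppS : tsupport θb ⊆ Ioo s₁ s₂ := by
    rw [θb.tsupport_eq]
    intro t ht
    rw [mem_closedBall, Real.dist_eq, abs_le] at ht
    have h1 := ht.1
    have h2 := ht.2
    have hr : θb.rOut = L / 3 := rfl
    rw [hr] at h1 h2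
    constructor <;> linarith
  have hθsupp : tsupport θb ⊆ Ioo (-1 : ℝ) 0 := hθsuppS.trans fun t ht =>
    ⟨lt_of_lt_of_le' ht.1 hs₁, lt_of_lt_of_le ht.2 hs₂⟩
  have hθK : IsCompact (tsupport θb) := by
    rw [θb.tsupport_eq]
    exact isCompact_closedBall _ _
  have hθint : L / 3 ≤ ∫ t, θb t := by
    have h := θb.measure_closedBall_le_integral (μ := volume)
    have hvol : volume.real (closedBall ((s₁ + s₂) / 2) θb.rIn) = L / 3 := by
      rw [measureReal_def, Real.volume_closedBall, ENNReal.toReal_ofReal (by positivity)]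
      show 2 * (L / 6) = L / 3
      ring
    rwa [hvol] at h
  have hθint0 : 0 ≤ ∫ t, θb t := θb.integral_pos.le
  set ψ : ℝ → EuclideanSpace ℝ (Fin 3) → EuclideanSpace ℝ (Fin 3) := fun t x => θb t • φ x with hψ
  have hψtest : IsSpaceTimeTestOn (parabolicCylinderOpens 1 ((0 : ℝ), (0 : EuclideanSpace ℝ (Fin 3)))) ψ :=
    landauTail_isSpaceTimeTestOn_smul hθs hθK hθsupp hφs hφc hφsupp1 hψ
  have hψS : tsupport (uncurry ψ) ⊆ Ioo s₁ s₂ ×ˢ ball (0 : EuclideanSpace ℝ (Fin 3)) ρ :=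
    landauTail_tsupport_smul_subset.trans (prod_mono hθsuppS hφsupp)
  have hψD : ∀ t x, ‖fderiv ℝ (ψ t) x‖ ≤ (K + 1) / ρ := by
    intro t x
    have hd : DifferentiableAt ℝ φ x := hφs.differentiable (by simp) x
    have e : fderiv ℝ (ψ t) x = θb t • fderiv ℝ φ x := by
      show fderiv ℝ (fun x => θb t • φ x) x = _
      exact fderiv_fun_const_smul hd (θb t)
    rw [e, norm_smul, Real.norm_eq_abs, abs_of_nonneg (θb.nonneg' t)]
    calc θb t * ‖fderiv ℝ φ x‖ ≤ 1 * (K / ρ) :=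
          mul_le_mul θb.le_one (hφD x) (norm_nonneg _) zero_le_one
      _ ≤ (K + 1) / ρ := by
          rw [one_mul]
          exact div_le_div_of_nonneg_right (by linarith) hρ.le
  have hψdiv : ∀ t, VectorCalculus.IsDivFree (ψ t) := by
    intro t x
    show VectorCalculus.divergence (fun x => θb t • φ x) x = 0
    rw [divergence_const_smul_apply (hφs.differentiable (by simp) x), hφdiv x, mul_zero]
  have hψslab : IsSpaceTimeTestOn (slab (EuclideanSpace ℝ (Fin 3)) (Ioo (-1) 0) isOpen_Ioo) ψ :=
    hψtest.mono fun z hz => by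
      have hz' : z ∈ parabolicCylinder 1 ((0 : ℝ), (0 : EuclideanSpace ℝ (Fin 3))) := hz
      rw [mem_parabolicCylinder] at hz'
      refine mem_slab.2 ⟨?_, hz'.1.2⟩
      have h1 := hz'.1.1
      norm_num at h1
      exact h1
  have hid : ∀ n, ∫ t in Ioo (-1 : ℝ) 0, ∫ x, (⟪w n t x, timeDeriv ψ t x⟫ +
      ⟪w n t x, convect (w n t) (ψ t) x⟫ + 1 * ⟪w n t x, Δ (ψ t) x⟫) = 0 := fun n =>
    (hwcl n).integral_veryWeak_eq_zero hψslab hψdiv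
  -- the value of the very weak functional of `U`: Landau's point flux
  have hval : ∫ t in Ioo (-1 : ℝ) 0, ∫ x, (⟪U x, timeDeriv ψ t x⟫ + ⟪U x, convect U (ψ t) x⟫ +
      1 * ⟪U x, Δ (ψ t) x⟫) = (∫ t, θb t) * (-Φ) := by
    rw [landauTail_veryWeak_smul_eq hUc hhom hθs hθsupp hφs hφc hφsupp1 hψ]
    congr 1
    obtain ⟨hV, hPV, hNSV, hdivV, hhomV, -⟩ := landauTail_landauAxisField_profile ha hA
    have hflux := landauTail_flux_identity (landauAxisField a A) (landauAxisPressure a A) φ hV hPV hNSV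
      hdivV hhomV (fun c hc x => landauAxisPressure_smul a A hc x) hφs hφc hφdiv
    rw [hφ0, landauTail_landau_flux_eq a A ha hA, landauTail_landau_flux_integral A hA] at hflux
    have hJV : ∫ x, (⟪U x, convect U φ x⟫ + ⟪U x, Δ φ x⟫) =
        ∫ x, (⟪landauAxisField a A x, convect (landauAxisField a A) φ x⟫ +
          ⟪landauAxisField a A x, Δ φ x⟫) := by
      refine integral_congr_ae ?_
      filter_upwards [compl_mem_ae_iff.2 (measure_singleton (0 : EuclideanSpace ℝ (Fin 3)))] with x hx
      simp only [convect, hUeq x hx, one_smul]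
    rw [hJV, hflux]
  have hXeq : ‖∫ t in Ioo (-1 : ℝ) 0, ∫ x, (⟪U x, timeDeriv ψ t x⟫ + ⟪U x, convect U (ψ t) x⟫ +
      1 * ⟪U x, Δ (ψ t) x⟫)‖ₑ = ENNReal.ofReal ((∫ t, θb t) * Φ) := by
    rw [hval, Real.enorm_eq_ofReal_abs, mul_neg, abs_neg, abs_of_nonneg (by positivity)]
  -- data for the defect inequality
  have hwc : ∀ n, ContinuousOn (uncurry (w n)) (Ioo (-1 : ℝ) 0 ×ˢ univ) := fun n =>
    (hwcl n).smooth_velocity.continuousOn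
  have hUm : AEStronglyMeasurable U volume := (landauTail_profile_measurable hUc).aestronglyMeasurable
  have hU52 := landauTail_eLpNorm_profile_five_halves_lt_top hUc hhom
  set S : Set (ℝ × EuclideanSpace ℝ (Fin 3)) := Ioo s₁ s₂ ×ˢ ball (0 : EuclideanSpace ℝ (Fin 3)) ρ
    with hSdef
  have hSm : MeasurableSet S := measurableSet_Ioo.prod measurableSet_ball
  have hae0 : ∀ᵐ z ∂(volume : Measure (ℝ × EuclideanSpace ℝ (Fin 3))), z.2 ≠ 0 := by
    have e : {z : ℝ × EuclideanSpace ℝ (Fin 3) | z.2 = 0} = univ ×ˢ {0} := by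
      ext z
      simp
    rw [ae_iff]
    simp only [not_not]
    rw [e, Measure.volume_eq_prod, Measure.prod_prod, measure_singleton, mul_zero]
  have hae : ∀ᵐ z ∂(volume.restrict S), Tendsto (fun n => w n z.1 z.2) atTop (𝓝 (U z.2)) := by
    rw [ae_restrict_iff' hSm]
    filter_upwards [hae0] with z hz hzS
    exact hptw z.1 ⟨lt_of_lt_of_le' hzS.1.1 hs₁, lt_of_lt_of_le hzS.1.2 hs₂⟩ z.2 hz
  -- the defects and the claim
  set D : ℕ → ℝ≥0∞ := fun n => ∫⁻ z in S, ‖w n z.1 z.2 - U z.2‖ₑ ^ 2 with hD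
  show ENNReal.ofReal (Φ / (3 * (K + 1)) * ρ * (s₂ - s₁)) ≤ liminf D atTop
  by_contra hcon
  rw [not_le] at hcon
  set b : ℝ≥0∞ := ENNReal.ofReal (Φ / (3 * (K + 1)) * ρ * (s₂ - s₁)) with hb
  -- a level strictly between the `liminf` and `b`, and a subsequence with defects below it
  obtain ⟨b', hb'1, hb'2⟩ := exists_between hcon
  have hfreq : ∃ᶠ n in atTop, D n < b' := frequently_lt_of_liminf_lt (by isBoundedDefault) hb'1
  obtain ⟨ns, hns, hnsD⟩ := extraction_of_frequently_atTop hfreq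
  have hbtop : b ≠ ⊤ := ENNReal.ofReal_ne_top
  have hb'top : b' ≠ ⊤ := (hb'2.trans_le le_top).ne
  set C : ℝ≥0 := (b' ^ (1 / 2 : ℝ)).toNNReal with hC
  have hCe : (C : ℝ≥0∞) = b' ^ (1 / 2 : ℝ) :=
    ENNReal.coe_toNNReal (ENNReal.rpow_ne_top_of_nonneg (by norm_num) hb'top)
  have hbd : ∀ k, eLpNorm (fun z : ℝ × EuclideanSpace ℝ (Fin 3) => w (ns k) z.1 z.2 - U z.2) 2
      (volume.restrict S) ≤ C := by
    intro k
    rw [hCe, eLpNorm_eq_lintegral_rpow_enorm_toReal two_ne_zero ENNReal.ofNat_ne_top, ENNReal.toReal_ofNat]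
    refine ENNReal.rpow_le_rpow ?_ (by norm_num)
    have h := (hnsD k).le
    simp only [hD] at h
    refine le_trans (le_of_eq ?_) h
    refine lintegral_congr fun z => ?_
    rw [← ENNReal.rpow_natCast]
    norm_num
  have haesub : ∀ᵐ z ∂(volume.restrict S), Tendsto (fun k => w (ns k) z.1 z.2) atTop (𝓝 (U z.2)) := by
    filter_upwards [hae] with z hz
    exact hz.comp hns.tendsto_atTop
  -- the defect inequality along the subsequence
  have hA4 := landauTail_veryWeak_defect_le (fun k => w (ns k)) U ψ s₁ s₂ ρ ((K + 1) / ρ) C hs₁ hs₁₂ hs₂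
    hρ hρ1 (fun k => hwc (ns k)) hψtest hψS hψD (fun k => hid (ns k)) hUm hU52 hbd haesub
  rw [hXeq] at hA4
  -- `liminf` along the subsequence is at most `b' < b`
  have hlim_le : liminf (fun k => ∫⁻ z in S, ‖w (ns k) z.1 z.2 - U z.2‖ₑ ^ 2) atTop ≤ b' :=
    liminf_le_of_frequently_le' (Eventually.of_forall fun k => (hnsD k).le).frequently
  have hM0 : ENNReal.ofReal ((K + 1) / ρ) ≠ 0 := by
    rw [Ne, ENNReal.ofReal_eq_zero, not_le]
    positivity
  have hMtop : ENNReal.ofReal ((K + 1) / ρ) ≠ ⊤ := ENNReal.ofReal_ne_top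
  -- `(K+1)/ρ · b = Φ L / 3 ≤ (∫θ) Φ`
  have hprod : ENNReal.ofReal ((K + 1) / ρ) * b = ENNReal.ofReal (L / 3 * Φ) := by
    rw [hb, ← ENNReal.ofReal_mul (by positivity)]
    congr 1
    rw [hL_def]
    field_simp
  have hchain : ENNReal.ofReal ((∫ t, θb t) * Φ) < ENNReal.ofReal ((∫ t, θb t) * Φ) :=
    calc ENNReal.ofReal ((∫ t, θb t) * Φ)
        ≤ ENNReal.ofReal ((K + 1) / ρ) *
            liminf (fun k => ∫⁻ z in S, ‖w (ns k) z.1 z.2 - U z.2‖ₑ ^ 2) atTop := hA4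
      _ ≤ ENNReal.ofReal ((K + 1) / ρ) * b' := by gcongr
      _ < ENNReal.ofReal ((K + 1) / ρ) * b := ENNReal.mul_lt_mul_right hM0 hMtop hb'2
      _ = ENNReal.ofReal (L / 3 * Φ) := hprod
      _ ≤ ENNReal.ofReal ((∫ t, θb t) * Φ) := by
          refine ENNReal.ofReal_le_ofReal ?_
          exact mul_le_mul_of_nonneg_right hθint hΦ.le
  exact lt_irrefl _ hchain

end Summit.NavierStokesRegularity.NavierStokesRegularity.Theorems

end
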